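import Literature.AlgebraicGeometry.Motives.MixedHodgeStructureJordanHolder
import Literature.AlgebraicGeometry.Motives.MixedHodgeStructureHodgeTateTopQuotient
import HarnessLib

/-!
# Dévissage of mixed Hodge structures: induction on the length and on the weights

Sequel to `MixedHodgeStructureJordanHolder` (the length `λ(H) = H.length`, `λ(S) + λ(H/S) = λ(H)`).
Beachy, *Introductory Lectures on Rings and Modules*, §2.5: the proof of the Jordan–Hölder theorem
(Thm. 2.5.2) "uses induction on `λ(M)`"; a module of finite length is an iterated extension of its simple
composition factors (Def. 2.5.1, Def. 2.5.3). Cattani–El Zein–Griffiths–Lê, *Hodge Theory*, Def. 3.2.15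
and Thm. 3.2.18: a mixed Hodge structure has a finite increasing weight filtration `W_•` by sub-MHS whose
graded pieces `Gr^W_k` are pure of weight `k` — so every MHS is an iterated extension of pure Hodge
structures (`0 → W_n H → H → H/W_n H → 0`, `W_n H` the lowest weight piece); Deligne, *Hodge II*, 2.3.1.

This file packages these dévissages as induction principles over all finite-dimensional mixed Hodge
structures on spaces in one universe (`P : ∀ {W} [..], MixedHodgeStructure W → Prop`; use as
`refine induction_on_… (P := fun {W} _ _ _ G => …) ?_ … H`):

* §1 **`length_induction`** (strong induction on `λ`); **`induction_on_simple_quotient`** /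
  **`induction_on_simple_sub`** (peel off a maximal sub-MHS `S`, `H/S` simple / a simple sub-MHS);
  **`induction_on_extension`** (`P(0)`, `P(simple)`, `P(S) ∧ P(H/S) ⟹ P(H)` give `P` for all).
* §2 the lowest weight piece `W_n H` (`W_{n-1} H = 0`) is pure of weight `n` (`isPure_weight_of_W_pred_eq_bot`)
  and the highest weight quotient `H / W_{b-1} H` (`W_b H = V`) is pure of weight `b`
  (`isPure_quotient_weight_of_W_eq_top`); `exists_isPure_weight`, `exists_isPure_quotient_weight`.
* §3 **`induction_on_lowest_weight`**, **`induction_on_highest_weight`**, **`induction_on_pure_extension`**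
  (`P(0)`, `P(pure)`, `P(S) ∧ P(H/S) ⟹ P(H)` give `P` for all); `length_quotient_weight_add`.

All statements proved; no definitions, no named facts, no instances.

## References

* [Beachy1999RingsModules] J. A. Beachy, Introductory Lectures on Rings and Modules (1999), §2.5, Def. 2.5.1,
  Thm. 2.5.2 (proof: "induction on `λ(M)`"), Def. 2.5.3 (held text, chunks p0098–p0099).
* [CattaniElZeinGriffithsLe2014] E. Cattani et al. (eds.), Hodge Theory (2014), Def. 3.2.15, Thm. 3.2.18,
  Ex. 3.2.23 (1), p. 270.
* [DeligneHodgeII1971] P. Deligne, Théorie de Hodge II, Publ. Math. IHÉS 40 (1971), 2.3.1.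
-/

noncomputable section

namespace Literature.AlgebraicGeometry.Motives

namespace MixedHodgeStructure

universe u

open SubMixedHodgeStructure

/-! ### §1 Induction on the length -/

/-- **Strong induction on the length `λ`** over all (finite-dimensional) mixed Hodge structures on spaces in
one universe: to prove `P H` one may assume `P` for all MHS of smaller length ("the proof uses induction on
`λ(M)`"). [cite: Beachy1999RingsModules, §2.5, proof of Thm. 2.5.2 and Def. 2.5.3] -/
theorem length_induction {P : ∀ {W : Type u} [AddCommGroup W] [Module ℚ W] [FiniteDimensional ℚ W], MixedHodgeStructure W → Prop}
    (h : ∀ {W : Type u} [AddCommGroup W] [Module ℚ W] [FiniteDimensional ℚ W] (G : MixedHodgeStructure W),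
      (∀ {W' : Type u} [AddCommGroup W'] [Module ℚ W'] [FiniteDimensional ℚ W'] (G' : MixedHodgeStructure W'),
        G'.length < G.length → P G') → P G)
    {V : Type u} [AddCommGroup V] [Module ℚ V] [FiniteDimensional ℚ V] (H : MixedHodgeStructure V) : P H := by
  suffices key : ∀ (n : ℕ) {W : Type u} [AddCommGroup W] [Module ℚ W] [FiniteDimensional ℚ W]
      (G : MixedHodgeStructure W), G.length = n → P G from key _ H rfl
  intro n
  induction n using Nat.strong_induction_on with
  | _ n ih =>
    intro W _ _ _ G hG
    exact h G fun G' hG' => ih G'.length (hG ▸ hG') G' rfl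

/-- **Dévissage along a maximal sub-MHS**: if `P` holds for the zero MHS and `P(S) ⟹ P(H)` whenever `S ⊆ H` is
a sub-MHS with simple quotient `H/S`, then `P` holds for every MHS. [cite: Beachy1999RingsModules, §2.5, Def. 2.5.1 and proof of Thm. 2.5.2]
[cite: CattaniElZeinGriffithsLe2014, Thm. 3.2.18 and p. 270] -/
theorem induction_on_simple_quotient {P : ∀ {W : Type u} [AddCommGroup W] [Module ℚ W] [FiniteDimensional ℚ W], MixedHodgeStructure W → Prop}
    (h0 : ∀ {W : Type u} [AddCommGroup W] [Module ℚ W] [FiniteDimensional ℚ W] [Subsingleton W] (G : MixedHodgeStructure W), P G)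
    (hstep : ∀ {W : Type u} [AddCommGroup W] [Module ℚ W] [FiniteDimensional ℚ W] (G : MixedHodgeStructure W)
      (S : SubMixedHodgeStructure G), S.quotient.IsSimple → P S.toMixedHodgeStructure → P G)
    {V : Type u} [AddCommGroup V] [Module ℚ V] [FiniteDimensional ℚ V] (H : MixedHodgeStructure V) : P H := by
  refine length_induction (P := P) (fun G ih => ?_) H
  rcases subsingleton_or_nontrivial _ with hW | hW
  · exact @h0 _ _ _ _ hW G
  · obtain ⟨S, hS⟩ := exists_isSimple_quotient G
    exact hstep G S hS (ih _ (S.length_toMixedHodgeStructure_lt (ne_top_of_isSimple_quotient S hS)))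

/-- **Dévissage along a simple sub-MHS**: if `P` holds for the zero MHS and `P(H/S) ⟹ P(H)` whenever `S ⊆ H`
is a simple sub-MHS, then `P` holds for every MHS. [cite: Beachy1999RingsModules, §2.5, Def. 2.5.1 and proof of Thm. 2.5.2]
[cite: CattaniElZeinGriffithsLe2014, Thm. 3.2.18 and p. 270] -/
theorem induction_on_simple_sub {P : ∀ {W : Type u} [AddCommGroup W] [Module ℚ W] [FiniteDimensional ℚ W], MixedHodgeStructure W → Prop}
    (h0 : ∀ {W : Type u} [AddCommGroup W] [Module ℚ W] [FiniteDimensional ℚ W] [Subsingleton W] (G : MixedHodgeStructure W), P G)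
    (hstep : ∀ {W : Type u} [AddCommGroup W] [Module ℚ W] [FiniteDimensional ℚ W] (G : MixedHodgeStructure W)
      (S : SubMixedHodgeStructure G), S.toMixedHodgeStructure.IsSimple → P S.quotient → P G)
    {V : Type u} [AddCommGroup V] [Module ℚ V] [FiniteDimensional ℚ V] (H : MixedHodgeStructure V) : P H := by
  refine length_induction (P := P) (fun G ih => ?_) H
  rcases subsingleton_or_nontrivial _ with hW | hW
  · exact @h0 _ _ _ _ hW G
  · obtain ⟨S, hS⟩ := exists_subMixedHodgeStructure_isSimple G
    haveI := hS.nontrivial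
    exact hstep G S hS (ih _ (S.length_quotient_lt (Submodule.nontrivial_iff_ne_bot.1 inferInstance)))

/-- **Dévissage by extensions**: a property of mixed Hodge structures which holds for `0`, for every simple
MHS, and for `H` as soon as it holds for a sub-MHS `S ⊆ H` and for `H/S`, holds for every MHS (every MHS is
an iterated extension of simple ones). [cite: Beachy1999RingsModules, §2.5, Def. 2.5.1 and Thm. 2.5.2]
[cite: CattaniElZeinGriffithsLe2014, Thm. 3.2.18 and p. 270] -/
theorem induction_on_extension {P : ∀ {W : Type u} [AddCommGroup W] [Module ℚ W] [FiniteDimensional ℚ W], MixedHodgeStructure W → Prop}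
    (h0 : ∀ {W : Type u} [AddCommGroup W] [Module ℚ W] [FiniteDimensional ℚ W] [Subsingleton W] (G : MixedHodgeStructure W), P G)
    (hsimple : ∀ {W : Type u} [AddCommGroup W] [Module ℚ W] [FiniteDimensional ℚ W] (G : MixedHodgeStructure W),
      G.IsSimple → P G)
    (hext : ∀ {W : Type u} [AddCommGroup W] [Module ℚ W] [FiniteDimensional ℚ W] (G : MixedHodgeStructure W)
      (S : SubMixedHodgeStructure G), P S.toMixedHodgeStructure → P S.quotient → P G)
    {V : Type u} [AddCommGroup V] [Module ℚ V] [FiniteDimensional ℚ V] (H : MixedHodgeStructure V) : P H :=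
  induction_on_simple_quotient (P := P) h0 (fun G S hS hPS => hext G S hPS (hsimple _ hS)) H

/-! ### §2 The lowest and the highest weight piece -/

section Weights

variable {V : Type u} [AddCommGroup V] [Module ℚ V] {H : MixedHodgeStructure V}

/-- **The lowest weight piece is pure**: if `W_{n-1} H = 0` then the sub-MHS `W_n H` is pure of weight `n`
(`W_n H = Gr^W_n H`). [cite: CattaniElZeinGriffithsLe2014, Def. 3.2.15 and Ex. 3.2.23 (1)] [cite: DeligneHodgeII1971, 2.3.1] -/
theorem isPure_weight_of_W_pred_eq_bot {n : ℤ} (hn : H.W (n - 1) = ⊥) : (weight H n).toMixedHodgeStructure.IsPure n := by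
  refine ⟨fun k hk => ?_, fun k hk => ?_⟩
  · show (H.W k).comap (H.W n).subtype = ⊥
    have hk' : H.W k = ⊥ := eq_bot_iff.2 ((H.monotone_W (show k ≤ n - 1 by omega)).trans hn.le)
    rw [hk', Submodule.comap_bot]
    exact Submodule.ker_subtype _
  · show (H.W k).comap (H.W n).subtype = ⊤
    exact Submodule.comap_subtype_eq_top.2 (H.monotone_W hk)

/-- **The highest weight quotient is pure**: if `W_b H = V` then `H / W_{b-1} H` is pure of weight `b`
(`= Gr^W_b H`). [cite: CattaniElZeinGriffithsLe2014, Def. 3.2.15 and Ex. 3.2.23 (1)] [cite: DeligneHodgeII1971, 2.3.1] -/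
theorem isPure_quotient_weight_of_W_eq_top {b : ℤ} (hb : H.W b = ⊤) : (weight H (b - 1)).quotient.IsPure b := by
  refine ⟨fun k hk => ?_, fun k hk => ?_⟩
  · rw [quotient_W, weight_toSubmodule, eq_bot_iff]
    calc (H.W k).map (H.W (b - 1)).mkQ ≤ (H.W (b - 1)).map (H.W (b - 1)).mkQ :=
          Submodule.map_mono (H.monotone_W (show k ≤ b - 1 by omega))
      _ = ⊥ := Submodule.mkQ_map_self _
      _ ≤ ⊥ := le_rfl
  · have hk' : H.W k = ⊤ := eq_top_iff.2 (hb.ge.trans (H.monotone_W hk))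
    rw [quotient_W, weight_toSubmodule, hk', Submodule.map_top, Submodule.range_mkQ]

/-- The lowest weight piece of a non-zero MHS is non-zero and pure. [cite: DeligneHodgeII1971, 2.3.1]
[cite: CattaniElZeinGriffithsLe2014, Def. 3.2.15] -/
theorem exists_isPure_weight [Nontrivial V] (H : MixedHodgeStructure V) :
    ∃ n : ℤ, H.W n ≠ ⊥ ∧ (weight H n).toMixedHodgeStructure.IsPure n := by
  obtain ⟨n, h₁, h₂⟩ := exists_lowestWeight H
  exact ⟨n, h₂, isPure_weight_of_W_pred_eq_bot h₁⟩

/-- The highest weight quotient of a non-zero MHS is non-zero and pure. [cite: DeligneHodgeII1971, 2.3.1]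
[cite: CattaniElZeinGriffithsLe2014, Def. 3.2.15] -/
theorem exists_isPure_quotient_weight [Nontrivial V] (H : MixedHodgeStructure V) :
    ∃ b : ℤ, H.W (b - 1) ≠ ⊤ ∧ (weight H (b - 1)).quotient.IsPure b := by
  obtain ⟨b, h₁, h₂⟩ := exists_highestWeight H
  exact ⟨b, h₂, isPure_quotient_weight_of_W_eq_top h₁⟩

end Weights

/-! ### §3 Induction on the weights: every MHS is an iterated extension of pure ones -/

/-- **Dévissage along the lowest weight**: if `P` holds for the zero MHS and `P(H / W_n H) ⟹ P(H)` whenever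
`W_n H ≠ 0` is the lowest weight piece (a pure sub-MHS of weight `n`, `H / W_n H` having fewer weights), then
`P` holds for every MHS — the extensions `0 → W_n H → H → H/W_n H → 0`. [cite: CattaniElZeinGriffithsLe2014, Def. 3.2.15 and Thm. 3.2.18]
[cite: DeligneHodgeII1971, 2.3.1] -/
theorem induction_on_lowest_weight {P : ∀ {W : Type u} [AddCommGroup W] [Module ℚ W] [FiniteDimensional ℚ W], MixedHodgeStructure W → Prop}
    (h0 : ∀ {W : Type u} [AddCommGroup W] [Module ℚ W] [FiniteDimensional ℚ W] [Subsingleton W] (G : MixedHodgeStructure W), P G)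
    (hstep : ∀ {W : Type u} [AddCommGroup W] [Module ℚ W] [FiniteDimensional ℚ W] (G : MixedHodgeStructure W) (n : ℤ),
      G.W n ≠ ⊥ → (weight G n).toMixedHodgeStructure.IsPure n → P (weight G n).quotient → P G)
    {V : Type u} [AddCommGroup V] [Module ℚ V] [FiniteDimensional ℚ V] (H : MixedHodgeStructure V) : P H := by
  refine length_induction (P := P) (fun G ih => ?_) H
  rcases subsingleton_or_nontrivial _ with hW | hW
  · exact @h0 _ _ _ _ hW G
  · obtain ⟨n, hn, hp⟩ := exists_isPure_weight G
    exact hstep G n hn hp (ih _ ((weight G n).length_quotient_lt hn))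

/-- **Dévissage along the highest weight**: if `P` holds for the zero MHS and `P(W_{b-1} H) ⟹ P(H)` whenever
`H / W_{b-1} H ≠ 0` is the highest weight quotient (pure of weight `b`), then `P` holds for every MHS — the
extensions `0 → W_{b-1} H → H → Gr^W_b H → 0`. [cite: CattaniElZeinGriffithsLe2014, Def. 3.2.15 and Thm. 3.2.18]
[cite: DeligneHodgeII1971, 2.3.1] -/
theorem induction_on_highest_weight {P : ∀ {W : Type u} [AddCommGroup W] [Module ℚ W] [FiniteDimensional ℚ W], MixedHodgeStructure W → Prop}
    (h0 : ∀ {W : Type u} [AddCommGroup W] [Module ℚ W] [FiniteDimensional ℚ W] [Subsingleton W] (G : MixedHodgeStructure W), P G)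
    (hstep : ∀ {W : Type u} [AddCommGroup W] [Module ℚ W] [FiniteDimensional ℚ W] (G : MixedHodgeStructure W) (b : ℤ),
      G.W (b - 1) ≠ ⊤ → (weight G (b - 1)).quotient.IsPure b → P (weight G (b - 1)).toMixedHodgeStructure → P G)
    {V : Type u} [AddCommGroup V] [Module ℚ V] [FiniteDimensional ℚ V] (H : MixedHodgeStructure V) : P H := by
  refine length_induction (P := P) (fun G ih => ?_) H
  rcases subsingleton_or_nontrivial _ with hW | hW
  · exact @h0 _ _ _ _ hW G
  · obtain ⟨b, hb, hp⟩ := exists_isPure_quotient_weight G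
    exact hstep G b hb hp (ih _ ((weight G (b - 1)).length_toMixedHodgeStructure_lt hb))

/-- **Every mixed Hodge structure is an iterated extension of pure ones**: a property which holds for `0`, for
every non-zero pure MHS, and for `H` as soon as it holds for a sub-MHS `S ⊆ H` and for `H/S`, holds for every
MHS. [cite: CattaniElZeinGriffithsLe2014, Def. 3.2.15 and Thm. 3.2.18] [cite: DeligneHodgeII1971, 2.3.1] -/
theorem induction_on_pure_extension {P : ∀ {W : Type u} [AddCommGroup W] [Module ℚ W] [FiniteDimensional ℚ W], MixedHodgeStructure W → Prop}
    (h0 : ∀ {W : Type u} [AddCommGroup W] [Module ℚ W] [FiniteDimensional ℚ W] [Subsingleton W] (G : MixedHodgeStructure W), P G)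
    (hpure : ∀ {W : Type u} [AddCommGroup W] [Module ℚ W] [FiniteDimensional ℚ W] [Nontrivial W]
      (G : MixedHodgeStructure W) (n : ℤ), G.IsPure n → P G)
    (hext : ∀ {W : Type u} [AddCommGroup W] [Module ℚ W] [FiniteDimensional ℚ W] (G : MixedHodgeStructure W)
      (S : SubMixedHodgeStructure G), P S.toMixedHodgeStructure → P S.quotient → P G)
    {V : Type u} [AddCommGroup V] [Module ℚ V] [FiniteDimensional ℚ V] (H : MixedHodgeStructure V) : P H := by
  refine induction_on_lowest_weight (P := P) h0 (fun G n hn hp hq => hext G (weight G n) ?_ hq) H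
  haveI : Nontrivial (weight G n).toSubmodule := Submodule.nontrivial_iff_ne_bot.2 hn
  exact hpure _ n hp

/-- **Induction on the number of weights**, numerically: `P` holds for every MHS if it holds for `0` and is
inherited from `H / W_n H` (lowest weight `n`) — where the length drops: `λ(H / W_n H) = λ(H) - λ(W_n H) < λ(H)`.
A restatement of `induction_on_lowest_weight` recording the length bookkeeping. [cite: Beachy1999RingsModules, §2.5, Def. 2.5.3]
[cite: CattaniElZeinGriffithsLe2014, Def. 3.2.15] -/
theorem length_quotient_weight_add {V : Type u} [AddCommGroup V] [Module ℚ V] [FiniteDimensional ℚ V]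
    (H : MixedHodgeStructure V) (n : ℤ) :
    (weight H n).quotient.length + (weight H n).toMixedHodgeStructure.length = H.length := by
  rw [add_comm]
  exact (weight H n).length_add_length_quotient

end MixedHodgeStructure

end Literature.AlgebraicGeometry.Motives
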